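import Literature.Probability.RandomPlanarGeometry.SAWBridgeRenewalEquation
import HarnessLib

/-!
# Half-space walks: `b_m h_n ≤ h_{m+n}` and the Lawler–Schramm–Werner renewal inequality
# `Σ_{j=1}^{n} λ_j h_{n-j} ≤ h_n` (every `ℤ^d`, `d ≥ 1`)

Topic `Literature/Probability/RandomPlanarGeometry`, on top of `SAWBridges.lean` (`Zd.halfSpaceWalks d n`,
`Zd.halfSpaceCount d n = h_n`, Madras–Slade Definition 3.1.2: `ω₁(i) > ω₁(0)` for `1 ≤ i ≤ n`; `Zd.bridges`,
`Zd.concatWalk`) and `SAWBridgeRenewalEquation.lean` (gluing / splitting of bridges at renewal times,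
`Zd.irreducibleBridges d n`, `λ_n`; (4.2.2) `b_n = Σ_{s=1}^{n} λ_s b_{n-s}`).

Source: G. F. Lawler, O. Schramm, W. Werner, *On the scaling limit of planar self-avoiding walk* (2004),
Appendix "The infinite half-space SAW" (arXiv:math/0204277, held text p0018): with `υ_n = h_n` and `s(ω)` the least
renewal time, "`μ_n{s(ω) = k} = λ_k υ_{n-k}/υ_n`" (L59–67: "`{s(ω) = k}` ↔ irreducible `k`-bridge × `Υ_{n-k}`") and
"`υ_n ≥ #{ω ∈ Υ_n : s(ω) ≤ k} = Σ_{j=1}^{k} λ_j υ_{n-j}`" (L81–85). What is proved here (lane pcv-sawmu, route R27 of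
the lane's planner, items R27.0 and R27.4; combinatorial, every `d ≥ 1`): the concatenation of a bridge and a
(translated) half-space walk is a half-space walk — **`b_m · h_n ≤ h_{m+n}`** (in particular `h_n ≤ h_{n+1}`,
`h_n ≤ h_{n+2}`, the "mixed supermultiplicativity" used for the lower Kesten rate of `h_{N+2}/h_N`) — and the
renewal INEQUALITY **`Σ_{j=1}^{n} λ_j h_{n-j} ≤ h_n`**: gluing an irreducible `j`-bridge and an `(n-j)`-step
half-space walk is injective in `(j, pieces)`, because `j` is recovered as the least time at which the head is a
bridge and the tail a half-space walk (an earlier such time would be a renewal time of the irreducible head).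
(The printed text asserts the IDENTITY `#{s(ω) = k} = λ_k υ_{n-k}`; only the inequality is proved and used.)

## Contents (namespace `Literature.Probability.RandomPlanarGeometry.SAW.Zd`), all PROVED, no definitions
* `isHalfSpace_add_const_iff`, `IsHalfSpace.congr`, `one_le_halfSpaceCount`;
* `concatWalk_mem_halfSpaceWalks` — bridge ∘ half-space walk is a half-space walk;
* **`bridgeCount_mul_halfSpaceCount_le`** — `b_m h_n ≤ h_{m+n}`; `halfSpaceCount_le_add_left` — `h_n ≤ h_{m+n}`;
* `isRenewalTime_of_halfSpace_tail` — if `W[0,j']` is a bridge and `W[j, n]` a half-space walk (`j < j' ≤ n`), then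
  `j` is a renewal time of the bridge `W[0,j']`;
* **`sum_irreducibleBridgeCount_mul_halfSpaceCount_le`** — `Σ_{j ∈ Icc 1 n} λ_j h_{n-j} ≤ h_n`.
-/

noncomputable section

open Finset Literature.Probability.LatticeModels Literature.Probability.Percolation SimpleGraph
open scoped BigOperators

namespace Literature.Probability.RandomPlanarGeometry.SAW.Zd

variable {d : ℕ} [NeZero d]

/-! ### Half-space walk algebra -/

/-- Translation invariance of the half-space condition. [cite: MadrasSlade1993, Definition 3.1.2] -/
theorem isHalfSpace_add_const_iff {n : ℕ} {ω : ℕ → Site d} (c : Site d) :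
    IsHalfSpace n (fun i => c + ω i) ↔ IsHalfSpace n ω := by
  simp only [IsHalfSpace, Pi.add_apply, add_lt_add_iff_left]

/-- Being an `n`-step half-space walk only depends on the first coordinates at times `0, …, n`.
[cite: MadrasSlade1993, Definition 3.1.2] -/
theorem IsHalfSpace.congr {n : ℕ} {ω ω' : ℕ → Site d} (h : IsHalfSpace n ω)
    (he : ∀ i ≤ n, ω i 0 = ω' i 0) : IsHalfSpace n ω' := by
  intro i h1 h2
  rw [← he 0 (Nat.zero_le _), ← he i h2]
  exact h i h1 h2

/-- `h_n ≥ 1` (bridges are half-space walks, `b_n ≥ 1`). [cite: MadrasSlade1993, §3.1] -/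
theorem one_le_halfSpaceCount (n : ℕ) : 1 ≤ halfSpaceCount d n :=
  le_trans (one_le_bridgeCount (d := d) n) (Finset.card_le_card (bridges_subset_halfSpaceWalks n))

/-! ### Gluing a bridge and a half-space walk -/

/-- **An `m`-step bridge followed by (the translate of) an `n`-step half-space walk is an `(m+n)`-step
half-space walk**: the bridge's sites have first coordinates in `[0, ω₁(m)]` (positive after time `0`), the
translated tail's sites have first coordinates `> ω₁(m)`. [cite: LawlerSchrammWerner2004SAW, Appendix (concatenation of bridges and half-space walks)] -/
theorem concatWalk_mem_halfSpaceWalks {m n : ℕ} {ω υ : ℕ → Site d} (hω : ω ∈ bridges d m)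
    (hυ : υ ∈ halfSpaceWalks d n) : concatWalk m ω υ ∈ halfSpaceWalks d (m + n) := by
  obtain ⟨hωs, hωb⟩ := mem_bridges.1 hω
  obtain ⟨hυs, hυh⟩ := mem_halfSpaceWalks.1 hυ
  have hω0 := (mem_saws.1 hωs).1
  have hυ0 := (mem_saws.1 hυs).1
  have h00 : (0 : Site d) 0 = 0 := rfl
  have hle : ∀ i ≤ m, ω i 0 ≤ ω m 0 := by
    intro i hi
    rcases Nat.eq_zero_or_pos i with rfl | hpos
    · rcases Nat.eq_zero_or_pos m with rfl | hm
      · exact le_rfl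
      · exact (hωb m hm le_rfl).1.le
    · exact (hωb i hpos hi).2
  have hgt : ∀ j, 1 ≤ j → j ≤ n → ω m 0 < (ω m + υ j) 0 := by
    intro j h1 h2
    have := hυh j h1 h2
    rw [hυ0, h00] at this
    simp only [Pi.add_apply]
    linarith
  refine mem_halfSpaceWalks.2 ⟨?_, ?_⟩
  · exact concatWalk_mem_saws hωs hυs fun i hi j h1 h2 heq => by
      have ha := hle i hi
      have hb := hgt j h1 h2
      rw [← heq] at hb
      exact absurd ha (not_le.2 hb)
  · intro i hi1 hi2
    have hstart : concatWalk m ω υ 0 = 0 := by simp [concatWalk, hω0]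
    rw [hstart, h00]
    have hm0 : 0 ≤ ω m 0 := by have := hle 0 (Nat.zero_le m); rwa [hω0] at this
    by_cases h : i ≤ m
    · rw [concatWalk_apply_of_le ω υ h]
      have := (hωb i hi1 h).1
      rwa [hω0, h00] at this
    · obtain ⟨j, rfl⟩ : ∃ j, i = m + j := ⟨i - m, by omega⟩
      rw [concatWalk_apply_add ω υ hυ0 j]
      have := hgt j (by omega) (by omega)
      linarith

/-- **`b_m · h_n ≤ h_{m+n}`** ("mixed supermultiplicativity": a bridge, then a half-space walk from its top;
injective by `Zd.concatWalk_injective_pieces`). [cite: LawlerSchrammWerner2004SAW, Appendix (concatenation of bridges and half-space walks); MadrasSlade1993, §1.2, eq. (1.2.15)] -/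
theorem bridgeCount_mul_halfSpaceCount_le (m n : ℕ) :
    bridgeCount d m * halfSpaceCount d n ≤ halfSpaceCount d (m + n) := by
  classical
  rw [bridgeCount, halfSpaceCount, halfSpaceCount, ← Finset.card_product]
  refine Finset.card_le_card_of_injOn (fun p => concatWalk m p.1 p.2) ?_ ?_
  · rintro ⟨ω, υ⟩ hp
    simp only [Finset.mem_coe, Finset.mem_product] at hp
    exact concatWalk_mem_halfSpaceWalks hp.1 hp.2
  · rintro ⟨ω, υ⟩ hp ⟨ω', υ'⟩ hp' h
    simp only [Finset.mem_coe, Finset.mem_product] at hp hp'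
    obtain ⟨h1, h2⟩ := concatWalk_injective_pieces (mem_bridges.1 hp.1).1 (mem_halfSpaceWalks.1 hp.2).1
      (mem_bridges.1 hp'.1).1 (mem_halfSpaceWalks.1 hp'.2).1 h
    rw [h1, h2]

/-- `h_n ≤ h_{m+n}` (prepend an `m`-step bridge, `b_m ≥ 1`); in particular `h_N ≤ h_{N+2}`, hypothesis (ii) of
Kesten's Lemma 7.3.1 for `φ_N = h_{N+2}/h_N`. [cite: MadrasSlade1993, Lemma 7.3.1 (hypothesis (ii)); LawlerSchrammWerner2004SAW, Appendix] -/
theorem halfSpaceCount_le_add_left (m n : ℕ) : halfSpaceCount d n ≤ halfSpaceCount d (m + n) :=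
  le_trans (Nat.le_mul_of_pos_left _ (one_le_bridgeCount (d := d) m)) (bridgeCount_mul_halfSpaceCount_le m n)

/-! ### The renewal inequality `Σ_{j=1}^{n} λ_j h_{n-j} ≤ h_n` -/

/-- If `W[0,j']` is a bridge (`j' ≤ n`) and the tail `W[j,n]` is a half-space walk from `W(j)` for some `j < j'`
at which `W[0,j]` is a bridge, then `j` is a renewal time of the bridge `W[0,j']`: on `[j, j']` the first
coordinates exceed `W₁(j)` (half-space tail) and are at most `W₁(j')` (bridge head).
[cite: LawlerSchrammWerner2004SAW, Appendix ("let s(ω) denote the smallest index j ≥ 1 such that …")] -/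
theorem isRenewalTime_of_halfSpace_tail {n j j' : ℕ} {W : ℕ → Site d} (hj : IsBridge j W)
    (hj' : IsBridge j' W) (hjj' : j < j') (hj'n : j' ≤ n)
    (htail : IsHalfSpace (n - j) (fun k => W (j + k))) : IsRenewalTime j' W j := by
  refine ⟨hjj'.le, hj, ?_⟩
  intro i hi1 hi2
  dsimp only
  have h1 := htail i hi1 (by omega)
  dsimp only at h1
  rw [add_zero] at h1
  refine ⟨h1, ?_⟩
  rw [show j + (j' - j) = j' by omega]
  exact (hj' (j + i) (by omega) (by omega)).2

/-- **The Lawler–Schramm–Werner renewal inequality `Σ_{j=1}^{n} λ_j h_{n-j} ≤ h_n`** (every `ℤ^d`, every `n`):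
the map `(j, η, τ) ↦ η ∘ τ` (an irreducible `j`-step bridge `η` glued to a translated `(n-j)`-step half-space walk
`τ`) is injective into the `n`-step half-space walks, `j` being the least time at which the head is a bridge and
the tail a half-space walk. [cite: LawlerSchrammWerner2004SAW, Appendix A, proof of (A.3), first display ("υ_n = #(Υ_n) ≥ #{ω ∈ Υ_n : s(ω) ≤ k} = Σ_{j=1}^{k} λ_j υ_{n-j}")] -/
theorem sum_irreducibleBridgeCount_mul_halfSpaceCount_le (n : ℕ) :
    ∑ j ∈ Icc 1 n, irreducibleBridgeCount d j * halfSpaceCount d (n - j) ≤ halfSpaceCount d n := by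
  classical
  have hcard : ((Icc 1 n).sigma fun j => irreducibleBridges d j ×ˢ halfSpaceWalks d (n - j)).card =
      ∑ j ∈ Icc 1 n, irreducibleBridgeCount d j * halfSpaceCount d (n - j) := by
    rw [card_sigma]
    simp_rw [card_product]
    rfl
  rw [← hcard, halfSpaceCount]
  refine Finset.card_le_card_of_injOn (fun p => concatWalk p.1 p.2.1 p.2.2) ?_ ?_
  · -- the gluing lands in the `n`-step half-space walks
    rintro ⟨j, η, τ⟩ hp
    simp only [mem_coe, mem_sigma, mem_Icc, mem_product] at hp
    obtain ⟨⟨-, hjn⟩, hη, hτ⟩ := hp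
    have h := concatWalk_mem_halfSpaceWalks (irreducibleBridges_subset_bridges j hη) hτ
    rw [Nat.add_sub_cancel' hjn] at h
    exact h
  · -- injectivity
    rintro ⟨j, η, τ⟩ hp ⟨j', η', τ'⟩ hp' h
    simp only [mem_coe, mem_sigma, mem_Icc, mem_product] at hp hp'
    obtain ⟨⟨hj1, hjn⟩, hη, hτ⟩ := hp
    obtain ⟨⟨hj1', hjn'⟩, hη', hτ'⟩ := hp'
    dsimp only at h
    have hηb := irreducibleBridges_subset_bridges j hη
    have hηb' := irreducibleBridges_subset_bridges j' hη'
    have hτ0 := (mem_saws.1 (mem_halfSpaceWalks.1 hτ).1).1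
    have hτ0' := (mem_saws.1 (mem_halfSpaceWalks.1 hτ').1).1
    -- heads are bridges, tails are half-space walks (for both gluings)
    have hB : IsBridge j (concatWalk j η τ) := isBridge_concatWalk_left.2 (mem_bridges.1 hηb).2
    have hB' : IsBridge j' (concatWalk j' η' τ') := isBridge_concatWalk_left.2 (mem_bridges.1 hηb').2
    have hT : IsHalfSpace (n - j) (fun k => concatWalk j η τ (j + k)) := by
      have e : (fun k => concatWalk j η τ (j + k)) = fun k => η j + τ k :=
        funext fun k => concatWalk_apply_add η τ hτ0 k
      rw [e, isHalfSpace_add_const_iff]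
      exact (mem_halfSpaceWalks.1 hτ).2
    have hT' : IsHalfSpace (n - j') (fun k => concatWalk j' η' τ' (j' + k)) := by
      have e : (fun k => concatWalk j' η' τ' (j' + k)) = fun k => η' j' + τ' k :=
        funext fun k => concatWalk_apply_add η' τ' hτ0' k
      rw [e, isHalfSpace_add_const_iff]
      exact (mem_halfSpaceWalks.1 hτ').2
    obtain rfl : j = j' := by
      by_contra hne
      rcases lt_or_gt_of_ne hne with hlt | hlt
      · -- `j < j'`: `j` would be a renewal time of the irreducible `η'`
        rw [h] at hB hT
        have hren := isRenewalTime_of_halfSpace_tail hB hB' hlt hjn' hT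
        have hren' : IsRenewalTime j' η' j :=
          hren.congr fun i hi => by rw [concatWalk_apply_of_le η' τ' hi]
        exact (mem_irreducibleBridges.1 hη').2.2.2 j hj1 (by omega) hren'
      · rw [← h] at hB' hT'
        have hren := isRenewalTime_of_halfSpace_tail hB' hB hlt hjn hT'
        have hren' : IsRenewalTime j η j' :=
          hren.congr fun i hi => by rw [concatWalk_apply_of_le η τ hi]
        exact (mem_irreducibleBridges.1 hη).2.2.2 j' hj1' (by omega) hren'
    obtain ⟨h1, h2⟩ := concatWalk_injective_pieces (mem_bridges.1 hηb).1 (mem_halfSpaceWalks.1 hτ).1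
      (mem_bridges.1 hηb').1 (mem_halfSpaceWalks.1 hτ').1 h
    subst h1 h2
    rfl

end Literature.Probability.RandomPlanarGeometry.SAW.Zd

end
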